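import Mathlib
import Summits.Parity.BatemanHorn.Theses.AlmostPrimeZeros

/-!
# Sketch — crux-ideate stmt-Parity-17114 (`AlmostPrimeZeros.DiscMajorantLog`), ideator 2, round 1

First-lemma signatures of the two idea cards (they only need to ELABORATE; nothing is proved here):

* card `switched-modulus-lsd`: `LargePrimeSwitchIdentity` (exact combinatorial identity for
  `f = X² + 1`) and `SwitchedModulusLSD` (the Hardy–Littlewood model of the switched sum obeys the
  crux's majorant with exponent `Re z = k(Re z − 1) + 1`, k = 1).
* card `charlier-descent`: `CharlierEnvelope` (the transfer target C⁺), `CharlierTransfer`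
  (C⁺ ⇒ crux, the glue), `LtwoJensen` (L²-Jensen: circle means of log|P| at centre 1 are bounded by
  the ℓ²-norm of the Charlier/Taylor coefficients of `P(1+w)e^{-cw}` — Parseval), `FibreContinuity`
  (the recursion's only external input, stated for one prime `p` and one root class).
-/

namespace Summit.Parity.BatemanHorn.Cruxes.DiscMajorantLog.Ideator2

open scoped BigOperators Classical
open Polynomial Finset
open Summit.Parity.BatemanHorn.Theses.AlmostPrimeZeros
open Literature.NumberTheory.Sieve

noncomputable section

/-- The capped statistic of one natural number: `s(m) = Σ_{p^v ∥ m} min(v,2)`. -/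
def sCap (m : ℕ) : ℕ := m.factorization.sum fun _ v => min v 2

/-- The system statistic `s_f(n) = Σ_i s((f_i(n))⁺)` (verbatim sub-term of the crux). -/
def sSys {k : ℕ} (f : Fin k → ℤ[X]) (n : ℕ) : ℕ :=
  ∑ i, (((f i).eval (n : ℤ)).toNat.factorization.sum fun _ v => min v 2)

/-! ## Card `switched-modulus-lsd` -/

/-- **Large-prime switch, exact form (f = X²+1).**  For `x ≥ 1`, `n² + 1 ≤ x² + 1` has at most one
prime factor `> x`, it occurs to the first power, and then `s(n²+1) = s(m) + 1` with
`m = (n²+1)/p ≤ x`; grouping the `n` with such a prime by the co-value `m` gives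
`S_x(z) = Σ_{n ≤ x, P⁺(n²+1) ≤ x} z^{s(n²+1)} + z · Σ_{1 ≤ m ≤ x} z^{s(m)} · #{n ≤ x : m ∣ n²+1, (n²+1)/m prime, (n²+1)/m > x}`.
(Provable now; S/M-sized.) -/
def LargePrimeSwitchIdentity : Prop :=
  ∀ x : ℕ, 1 ≤ x → ∀ z : ℂ,
    (∑ n ∈ range (x + 1), z ^ sCap (n ^ 2 + 1)) =
      (∑ n ∈ (range (x + 1)).filter (fun n => ∀ p : ℕ, p.Prime → p ∣ n ^ 2 + 1 → p ≤ x),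
          z ^ sCap (n ^ 2 + 1)) +
        z * ∑ m ∈ Icc 1 x, z ^ sCap m *
          (#((range (x + 1)).filter fun n =>
              m ∣ n ^ 2 + 1 ∧ ((n ^ 2 + 1) / m).Prime ∧ x < (n ^ 2 + 1) / m) : ℂ)

/-- **The switched model obeys the crux majorant (f = X²+1, k = 1).**  Replacing the prime count
`#{n ≤ x : (n²+1)/m prime > x}` by its Hardy–Littlewood/sieve model `𝔖₀ ρ_f(m) x/(m log(x²/m))`
turns the switched sum into `x/log x` times the logarithmic mean value of the MULTIPLICATIVE function
`m ↦ z^{s(m)} ρ_f(m)` (`ρ_f = polyRootCountMod`, CRT-multiplicative, mean value `1` over primes),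
which Selberg–Delange with `R ≍ log log x` evaluates as `c(z)(log x)^z/Γ(z+1)`: modulus
`(log x)^{Re z} e^{O(|z| log |z|)}` — i.e. EXACTLY the crux's `x (log x)^{k(Re z−1)}` after the factor
`x/log x`, on both half-planes.  Signature of that mean-value bound: -/
def SwitchedModulusLSD : Prop :=
  ∃ A C : ℝ, ∃ x₀ : ℕ, ∀ x : ℕ, x₀ ≤ x → ∀ z : ℂ, ‖z - 1‖ ≤ 3 * Real.log (Real.log (x : ℝ)) →
    ‖∑ m ∈ Icc 1 x, z ^ sCap m *
        ((polyRootCountMod ![(X ^ 2 + 1 : ℤ[X])] m : ℂ) / (m : ℂ))‖ ≤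
      A * (Real.log (x : ℝ)) ^ (z.re) * Real.exp (C * ‖z - 1‖ * Real.log (‖z - 1‖ + 2))

/-- **The residual stub of the card (f = X²+1), stated as the dispersion/bilinear estimate it is.**
The switched sum minus its model is small at the crux's precision: the prime counts in the
one-parameter family of discriminant-(−4) quadratics `q_{m,ν}(t) = ((ν+tm)²+1)/m` follow the
Hardy–Littlewood model ON AVERAGE over `m ≤ x` against the complex multiplicative weights
`z^{s(m)}`.  (Type-I₂/Type-II information for `n²+1`; arXiv:1908.08816 covers a window of `m`.) -/
def SwitchedDispersion : Prop :=
  ∃ 𝔖 : ℝ, ∃ A C : ℝ, ∃ x₀ : ℕ, ∀ x : ℕ, x₀ ≤ x → ∀ z : ℂ, ‖z - 1‖ ≤ 3 * Real.log (Real.log (x : ℝ)) →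
    ‖∑ m ∈ Icc 1 x, z ^ sCap m *
        ((#((range (x + 1)).filter fun n =>
              m ∣ n ^ 2 + 1 ∧ ((n ^ 2 + 1) / m).Prime ∧ x < (n ^ 2 + 1) / m) : ℂ) -
          (𝔖 : ℂ) * (polyRootCountMod ![(X ^ 2 + 1 : ℤ[X])] m : ℂ) * (x : ℂ) /
            ((m : ℂ) * (Real.log ((x : ℝ) ^ 2 / m) : ℂ)))‖ ≤
      A * (x : ℝ) * (Real.log (x : ℝ)) ^ (z.re - 1 - 1 / 4 : ℝ) *
        Real.exp (C * ‖z - 1‖ * Real.log (‖z - 1‖ + 2))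

/-! ## Card `charlier-descent` -/

/-- `D_m(x)` (un-normalised): `(x+1)·E[C_m(s_f(n); kL)]`, the `m`-th Charlier moment of the law of
`s_f(n)`, `n` uniform on `{0,…,x}`, w.r.t. the Poisson law of parameter `λ = k log log x`:
`C_m(s; λ) = Σ_i (m choose i) (s)_i (−λ)^{m−i}`, generating function `(1+w)^s e^{−λw} = Σ_m C_m w^m/m!`. -/
def charlierMoment {k : ℕ} (f : Fin k → ℤ[X]) (x m : ℕ) : ℝ :=
  ∑ n ∈ range (x + 1), ∑ i ∈ range (m + 1),
    (m.choose i : ℝ) * ((sSys f n).descFactorial i : ℝ) *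
      (-((k : ℝ) * Real.log (Real.log (x : ℝ)))) ^ (m - i)

/-- **Transfer target C⁺ (`CharlierEnvelope`).**  For every Bateman–Horn system the Charlier
moments of `s_f` w.r.t. Poisson(`k log log x`) satisfy `|D_m(x)| ≤ A (x+1) (C log(m+2))^m` for all
`m` and all large `x`.  Equivalent, up to the values of `A, C`, to the crux ON EVERY DISC
(Cauchy estimates one way, `Σ_m (C|w|log(m+2))^m/m! ≤ e^{C'|w|log(|w|+2)}` the other); it is
direction-free, linear in the empirical law of `s_f` (superposition), and stable under bounded shifts
`s ↦ s + j` and recentrings `λ ↦ λ + δ` (factor `(1+w)^j e^{−δw}` keeps the class `(C log m)^m`). -/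
def CharlierEnvelope : Prop :=
  ∀ (k : ℕ) (f : Fin k → ℤ[X]), IsBatemanHornSystem f → ∃ A C : ℝ, ∃ x₀ : ℕ, ∀ x : ℕ, x₀ ≤ x →
    ∀ m : ℕ, |charlierMoment f x m| ≤ A * ((x : ℝ) + 1) * (C * Real.log ((m : ℝ) + 2)) ^ m

/-- **First lemma of the card (the glue C⁺ ⇒ crux; provable now, M-sized):**
`S_x(1+w) = e^{kLw} Σ_m D_m(x) w^m/m!` (finite sum, `D_m = 0` for `m > deg S_x + …` is NOT needed:
the series terminates in `i` and converges absolutely in `m`), hence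
`‖S_x(z)‖ ≤ (log x)^{k(Re z−1)} A (x+1) Σ_m (C log(m+2) ‖z−1‖)^m/m! ≤ 2A x (log x)^{k(Re z−1)} e^{C'‖z−1‖log(‖z−1‖+2)}`. -/
def CharlierTransfer : Prop := CharlierEnvelope → DiscMajorantLog

/-- **L²-Jensen (provable now, M-sized; feeds the PARENT crux directly from coefficient bounds).**
For `P ∈ ℂ[z]` with `P(1) ≠ 0`, any real recentring `c` and radius `r > 0`:
`Σ_{‖1−ρ‖<r} log(r/‖1−ρ‖) ≤ ½ log( Σ_m ‖F^{(m)}(0)/m!‖² r^{2m} / ‖P(1)‖² )`, `F(w) = P(1+w)e^{−cw}`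
(Jensen at centre 1; the harmonic term `−c r cos θ` averages to zero; concavity of log; Parseval). -/
def LtwoJensen : Prop :=
  ∀ (P : ℂ[X]) (c r : ℝ), P.eval 1 ≠ 0 → 0 < r →
    ((P.roots.filter fun ρ => ‖1 - ρ‖ < r).map fun ρ => Real.log (r / ‖1 - ρ‖)).sum ≤
      (1 / 2) * Real.log
        ((∑' m : ℕ, ‖iteratedDeriv m (fun w : ℂ => P.eval (1 + w) * Complex.exp (-(c : ℂ) * w)) 0‖ ^ 2 /
            ((m.factorial : ℝ) ^ 2) * r ^ (2 * m)) / ‖P.eval 1‖ ^ 2)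

/-- **The recursion's external input (`FibreContinuity`), one prime and one root class at a time.**
Along the size-bias recursion `D_m(f;x) = Σ_p Σ_ν (ρ-weights)·[D_{m−1} on the fibre n ≡ ν (p)] − …`
the Poisson part cancels exactly; what must be supplied is that the Charlier moments of the
`p`-DEPRIVED statistic on the fibre `{n ≤ x : n ≡ ν (mod p)}` equal `1/p` times the global ones up to
`(1/p + log p/log x)` of the envelope.  Stated here for `f = X²+1` and the root classes `ν² ≡ −1 (p)`. -/
def FibreContinuity : Prop :=
  ∃ A C : ℝ, ∃ x₀ : ℕ, ∀ x : ℕ, x₀ ≤ x → ∀ p : ℕ, p.Prime → (p : ℝ) ≤ Real.sqrt x →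
    ∀ ν : ℕ, ν < p → (p : ℤ) ∣ (ν : ℤ) ^ 2 + 1 → ∀ m : ℕ,
      |(∑ n ∈ (range (x + 1)).filter (fun n => n % p = ν), ∑ i ∈ range (m + 1),
          (m.choose i : ℝ) * ((sCap ((n ^ 2 + 1) / p ^ (n ^ 2 + 1).factorization p)).descFactorial i : ℝ) *
            (-(Real.log (Real.log (x : ℝ)))) ^ (m - i)) -
        (1 / (p : ℝ)) * ∑ n ∈ range (x + 1), ∑ i ∈ range (m + 1),
          (m.choose i : ℝ) * ((sCap ((n ^ 2 + 1) / p ^ (n ^ 2 + 1).factorization p)).descFactorial i : ℝ) *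
            (-(Real.log (Real.log (x : ℝ)))) ^ (m - i)|
        ≤ A * ((x : ℝ) / p) * (1 / (p : ℝ) + Real.log p / Real.log x) * (C * Real.log ((m : ℝ) + 2)) ^ m

end

end Summit.Parity.BatemanHorn.Cruxes.DiscMajorantLog.Ideator2
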